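import Summits.CriticalPhenomena.SAWScalingLimit.Theorems.SAWTotalPositivityCriticalBubbleBoundKestenHWCut
import Literature.Probability.RandomPlanarGeometry.SAWWordBridges
import Literature.Probability.RandomPlanarGeometry.SAWUnfoldingStep
import Literature.Probability.RandomPlanarGeometry.SelfAvoidingWalk
import HarnessLib

/-!
# Line `kesten-product-renewal-dictionary` for the crux `SAWTotalPositivity.CriticalBubbleBound`
(stmt-CriticalPhenomena-7117): an effective bound on the length-weighted critical bridge mass of
given span (stub H6, word model)

In the step-word model of self-avoiding walks on `ℤ²` (`SAWWords.lean`, `SAWWordBridges.lean`: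
`traj w i` is the position after `i` steps, `xAt w i = traj w i 0` the first coordinate, `xEnd w`
the span, `IsBridgeW w` the bridge condition `0 < x(i) ≤ x(|w|)` for `1 ≤ i ≤ |w|`) we prove
`spanLengthWordMass_le`: IF for all `N, h` the critical mass `∑ x_c^{|u|}` of the self-avoiding
half-space words `u` (`0 < x(i)` for `1 ≤ i ≤ |u|`, `Zd.IsHalfSpace`) of length `≤ N` and maximal
first coordinate `Zd.maxLevel ≤ h` is at most `2 ^ h` (the hypothesis; it is Kesten's bound, supplied
by the neighbouring stubs of the line), THEN for all `N, h` the LENGTH-WEIGHTED critical mass of the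
self-avoiding bridge words of span `h` and length `≤ N` satisfies
`Λ_h^{(N)} = ∑ |w| x_c^{|w|} ≤ 2 μ 4^h` (`x_c = criticalFugacity = μ⁻¹`, `μ = connectiveConstant`).

Proof (marked-step splitting, an elementary instance of the cut-and-reverse arguments of
Madras–Slade 1993, §3.1): `|w| x_c^{|w|} = ∑_{k < |w|} x_c^{|w|}`, and a bridge word `w` of span `h`
marked at `k < |w|` is sent to the pair `(u, z') = (w.take k, 0 :: (w.drop k).reverse)`. The prefix
`u` is a half-space word of maximum `≤ h` (`take_isHalfSpace`). Reversing a word is time reversal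
composed with the rotation by `π` (`traj_reverse`: `traj w.reverse j = wEnd w - traj w (|w| - j)`), so
the reversed suffix is self-avoiding with first coordinates `h - x_w(|w| - j) ∈ [0, h]`
(`xAt_reverse_drop_mem`), and one extra first step `+e₀` makes it a half-space word `z'` of length
`|w| - k + 1 ≤ N + 1` and maximum `≤ h + 1` (`cons_reverse_drop_spec`). The map `(w, k) ↦ (u, z')` is
injective (`w = u ++ (z'.tail).reverse`, `k = |u|`) and `x_c^{|w|} = μ · x_c^{|u|} x_c^{|z'|}` since
`|u| + |z'| = |w| + 1` and `μ x_c = 1`; summing over the product of the two sets of half-space words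
gives `Λ_h^{(N)} ≤ μ · 2^h · 2^{h+1}` (`lengthWordMass_le_of_split`).

## References

* N. Madras, G. Slade, *The Self-Avoiding Walk*, Birkhäuser (1993), Definition 1.2.4 (bridges),
  §3.1 (half-space walks, Definition 3.1.2; cutting and reflecting walks, proof of Theorem 3.1.1),
  §4.2 (Kesten's renewal structure of bridges). The estimate itself is elementary. [folklore]
-/

noncomputable section

open Literature.Probability.LatticeModels
open Literature.Probability.RandomPlanarGeometry Literature.Probability.RandomPlanarGeometry.SAW
open scoped ENNReal NNReal BigOperators
open Classical

namespace Summit.CriticalPhenomena.SAWScalingLimit.Theorems.CriticalBubbleBound.Kesten.HW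

/-! ## Reversed words: time reversal composed with the rotation by `π` -/

/-- Reversing a word does not change its endpoint. [folklore] -/
theorem wEnd_reverse (w : List Step) : wEnd w.reverse = wEnd w := by
  simp only [wEnd, List.map_reverse, List.sum_reverse]

/-- The endpoint of a suffix: `wEnd (w.drop k) = wEnd w - traj w k`. [folklore] -/
theorem wEnd_drop (w : List Step) (k : ℕ) : wEnd (w.drop k) = wEnd w - traj w k := by
  have h := wEnd_append (w.take k) (w.drop k)
  rw [List.take_append_drop] at h
  rw [traj, h, add_sub_cancel_left]

/-- **Trajectory of the reversed word**: `traj w.reverse j = wEnd w - traj w (|w| - j)`. Reading a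
walk backwards from its endpoint and rotating by `π` gives again a nearest-neighbour walk from the
origin, whose step word is `w.reverse`. [folklore] -/
theorem traj_reverse (w : List Step) (j : ℕ) :
    traj w.reverse j = wEnd w - traj w (w.length - j) := by
  show wEnd (w.reverse.take j) = wEnd w - traj w (w.length - j)
  rw [List.take_reverse, wEnd_reverse, wEnd_drop]

/-- First coordinates of the reversed word: `x_{w.reverse}(j) = xEnd w - x_w(|w| - j)`. [folklore] -/
theorem xAt_reverse (w : List Step) (j : ℕ) :
    xAt w.reverse j = xEnd w - xAt w (w.length - j) := by
  simp only [xAt, xEnd_eq, traj_reverse, Pi.sub_apply]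

/-- The reverse of a self-avoiding word is self-avoiding. [folklore] -/
theorem isSAW_reverse {w : List Step} (h : IsSAW w) : IsSAW w.reverse := by
  rw [isSAW_iff_injOn] at h ⊢
  intro i hi j hj hij
  simp only [Set.mem_setOf_eq, List.length_reverse] at hi hj
  rw [traj_reverse, traj_reverse, sub_right_inj] at hij
  have := h (show w.length - i ≤ w.length from Nat.sub_le _ _) (Nat.sub_le _ _) hij
  omega

/-! ## Pieces of a bridge word -/

/-- All first coordinates of a bridge word are non-negative. [cite: MadrasSlade1993, Definition 1.2.4] -/
theorem xAt_nonneg_of_isBridgeW {w : List Step} (hb : IsBridgeW w) (i : ℕ) : 0 ≤ xAt w i := by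
  rcases Nat.eq_zero_or_pos i with rfl | hi
  · rw [xAt_zero]
  · rcases le_or_gt i w.length with h | h
    · exact ((isBridgeW_iff w).1 hb i hi h).1.le
    · rw [xAt_of_le w h.le]
      exact hb.xEnd_nonneg

/-- A prefix of a bridge word is a half-space word (its first coordinates are those of `w`,
positive after time `0`) whose maximal first coordinate is at most the span of `w`.
[cite: MadrasSlade1993, §3.1] -/
theorem take_isHalfSpace {w : List Step} (hb : IsBridgeW w) (k : ℕ) :
    Zd.IsHalfSpace (w.take k).length (traj (w.take k)) ∧
      Zd.maxLevel (w.take k).length (traj (w.take k)) ≤ xEnd w := by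
  have hk : ∀ i ≤ (w.take k).length, i ≤ k ∧ i ≤ w.length := fun i hi => by
    rw [List.length_take] at hi
    omega
  refine ⟨fun i h1 h2 => ?_, Zd.maxLevel_le fun i hi => ?_⟩
  · show xAt (w.take k) 0 < xAt (w.take k) i
    rw [xAt_zero, xAt, traj_take w (hk i h2).1]
    exact ((isBridgeW_iff w).1 hb i h1 (hk i h2).2).1
  · show xAt (w.take k) i ≤ xEnd w
    rw [xAt, traj_take w (hk i hi).1]
    exact hb.xAt_le i

/-- First coordinates of the reversed suffix of a word:
`x_{(w.drop k).reverse}(j) = xEnd w - x_w(k + (|w| - k - j))` for `k ≤ |w|`. [folklore] -/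
theorem xAt_reverse_drop {w : List Step} {k : ℕ} (hk : k ≤ w.length) (j : ℕ) :
    xAt (w.drop k).reverse j = xEnd w - xAt w (k + (w.length - k - j)) := by
  simp only [xAt_reverse, xEnd, List.length_drop, xAt_drop hk, Nat.add_sub_cancel' hk]
  ring

/-- For a bridge word `w` of span `L` and `k ≤ |w|`, the first coordinates of the reversed suffix
`(w.drop k).reverse` lie in `[0, L]`. [cite: MadrasSlade1993, §3.1] -/
theorem xAt_reverse_drop_mem {w : List Step} (hb : IsBridgeW w) {k : ℕ} (hk : k ≤ w.length)
    (j : ℕ) : 0 ≤ xAt (w.drop k).reverse j ∧ xAt (w.drop k).reverse j ≤ xEnd w := by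
  rw [xAt_reverse_drop hk]
  have h1 := hb.xAt_le (k + (w.length - k - j))
  have h2 := xAt_nonneg_of_isBridgeW hb (k + (w.length - k - j))
  constructor <;> linarith

/-- One more initial step: `traj (d :: z) (j + 1) = vec d + traj z j`. [folklore] -/
theorem traj_cons_succ (d : Step) (z : List Step) (j : ℕ) :
    traj (d :: z) (j + 1) = Step.vec d + traj z j := by
  simp only [traj, List.take_succ_cons, wEnd_cons]

/-- First coordinates after prepending the step `+e₀`: `x_{0 :: z}(j + 1) = 1 + x_z(j)`.
[folklore] -/
theorem xAt_cons_zero_succ (z : List Step) (j : ℕ) :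
    xAt ((0 : Step) :: z) (j + 1) = 1 + xAt z j := by
  simp [xAt, traj_cons_succ, Step.dx]

/-- **The reversed suffix, shifted by `+e₀`.** For a self-avoiding bridge word `w` of span `L` and
`k ≤ |w|`, the word `z' = 0 :: (w.drop k).reverse` is self-avoiding (the reversed suffix is, and its
shifted positions have first coordinate `≥ 1`, so none is the origin), is a half-space word, and has
maximal first coordinate `≤ L + 1`. [cite: MadrasSlade1993, §3.1] -/
theorem cons_reverse_drop_spec {w : List Step} (hs : IsSAW w) (hb : IsBridgeW w) {k : ℕ}
    (hk : k ≤ w.length) :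
    IsSAW ((0 : Step) :: (w.drop k).reverse) ∧
      Zd.IsHalfSpace ((0 : Step) :: (w.drop k).reverse).length
          (traj ((0 : Step) :: (w.drop k).reverse)) ∧
        Zd.maxLevel ((0 : Step) :: (w.drop k).reverse).length
          (traj ((0 : Step) :: (w.drop k).reverse)) ≤ xEnd w + 1 := by
  have hzs : IsSAW (w.drop k).reverse := isSAW_reverse (hs.drop k)
  have hx : ∀ j, 0 ≤ xAt (w.drop k).reverse j ∧ xAt (w.drop k).reverse j ≤ xEnd w :=
    xAt_reverse_drop_mem hb hk
  have hpos : ∀ j, 0 < xAt ((0 : Step) :: (w.drop k).reverse) (j + 1) := fun j => by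
    rw [xAt_cons_zero_succ]
    linarith [(hx j).1]
  refine ⟨?_, fun i h1 _ => ?_, Zd.maxLevel_le fun i _ => ?_⟩
  · rw [isSAW_iff_injOn] at hzs ⊢
    rintro (_ | i) hi (_ | j) hj hij
    · rfl
    · exfalso
      have h0 : xAt ((0 : Step) :: (w.drop k).reverse) 0 =
          xAt ((0 : Step) :: (w.drop k).reverse) (j + 1) := congrFun hij 0
      rw [xAt_zero] at h0
      linarith [hpos j]
    · exfalso
      have h0 : xAt ((0 : Step) :: (w.drop k).reverse) (i + 1) =
          xAt ((0 : Step) :: (w.drop k).reverse) 0 := congrFun hij 0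
      rw [xAt_zero] at h0
      linarith [hpos i]
    · simp only [Set.mem_setOf_eq, List.length_cons] at hi hj
      rw [traj_cons_succ, traj_cons_succ, add_right_inj] at hij
      rw [hzs (show i ≤ (w.drop k).reverse.length by omega)
        (show j ≤ (w.drop k).reverse.length by omega) hij]
  · obtain ⟨j, rfl⟩ : ∃ j, i = j + 1 := ⟨i - 1, by omega⟩
    show xAt _ 0 < xAt _ (j + 1)
    rw [xAt_zero]
    exact hpos j
  · rcases i with _ | j
    · show xAt _ 0 ≤ xEnd w + 1
      rw [xAt_zero]
      linarith [hb.xEnd_nonneg]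
    · show xAt _ (j + 1) ≤ xEnd w + 1
      rw [xAt_cons_zero_succ]
      linarith [(hx j).2]

/-! ## The marked-step splitting -/

/-- **Marked-step splitting (abstract form).** Let `B` be a finite set of self-avoiding bridge words
of span `L` and length `≤ N`, and let `H₁ ⊇ {self-avoiding half-space words of maximum ≤ L and
length ≤ N}`, `H₂ ⊇ {self-avoiding half-space words of maximum ≤ L + 1 and length ≤ N + 1}` be
finite sets of critical masses `≤ b₁`, `≤ b₂`. Then `∑_{w ∈ B} |w| x_c^{|w|} ≤ μ b₁ b₂`: the marked
bridge `(w, k)`, `k < |w|`, is sent injectively to `(w.take k, 0 :: (w.drop k).reverse) ∈ H₁ × H₂`,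
and `x_c^{|w|} = μ x_c^{k} x_c^{|w| - k + 1}`. [cite: MadrasSlade1993, §3.1] -/
theorem lengthWordMass_le_of_split {B H₁ H₂ : Finset (List Step)} {L : ℤ} {N : ℕ} {b₁ b₂ : ℝ}
    (hB : ∀ w ∈ B, IsSAW w ∧ IsBridgeW w ∧ xEnd w = L ∧ w.length ≤ N)
    (hH₁ : ∀ u : List Step, IsSAW u → Zd.IsHalfSpace u.length (traj u) →
      Zd.maxLevel u.length (traj u) ≤ L → u.length ≤ N → u ∈ H₁)
    (hH₂ : ∀ z : List Step, IsSAW z → Zd.IsHalfSpace z.length (traj z) →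
      Zd.maxLevel z.length (traj z) ≤ L + 1 → z.length ≤ N + 1 → z ∈ H₂)
    (hb₁ : ∑ u ∈ H₁, criticalFugacity ^ u.length ≤ b₁)
    (hb₂ : ∑ z ∈ H₂, criticalFugacity ^ z.length ≤ b₂) :
    ∑ w ∈ B, (w.length : ℝ) * criticalFugacity ^ w.length ≤ connectiveConstant * (b₁ * b₂) := by
  have hμ : 0 < connectiveConstant := by
    have h := Zd.connectiveConstant_pos 2
    rwa [Zd.connectiveConstant_two] at h
  have hx0 : 0 ≤ criticalFugacity := inv_nonneg.2 hμ.le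
  have hμx : connectiveConstant * criticalFugacity = 1 := mul_inv_cancel₀ hμ.ne'
  -- the marked bridges `(w, k)`, `k < |w|`
  have memD : ∀ p ∈ B.sigma (fun w => Finset.range w.length),
      IsSAW p.1 ∧ IsBridgeW p.1 ∧ xEnd p.1 = L ∧ p.1.length ≤ N ∧ p.2 < p.1.length := by
    intro p hp
    rw [Finset.mem_sigma, Finset.mem_range] at hp
    obtain ⟨h1, h2, h3, h4⟩ := hB p.1 hp.1
    exact ⟨h1, h2, h3, h4, hp.2⟩
  have e1 : ∑ w ∈ B, (w.length : ℝ) * criticalFugacity ^ w.length =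
      ∑ p ∈ B.sigma (fun w => Finset.range w.length), criticalFugacity ^ p.1.length := by
    rw [Finset.sum_sigma]
    refine Finset.sum_congr rfl fun w _ => ?_
    simp only [Finset.sum_const, Finset.card_range, nsmul_eq_mul]
  -- the weight splits: `x_c^{|w|} = μ x_c^{|u|} x_c^{|z'|}`
  have e2 : ∀ p ∈ B.sigma (fun w => Finset.range w.length),
      criticalFugacity ^ p.1.length = connectiveConstant *
        (criticalFugacity ^ (p.1.take p.2).length *
          criticalFugacity ^ ((0 : Step) :: (p.1.drop p.2).reverse).length) := by
    intro p hp
    have hk := (memD p hp).2.2.2.2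
    rw [← pow_add, List.length_take, List.length_cons, List.length_reverse, List.length_drop,
      min_eq_left hk.le, show p.2 + (p.1.length - p.2 + 1) = p.1.length + 1 by omega, pow_succ,
      mul_left_comm, hμx, mul_one]
  -- the splitting map is injective on the marked bridges
  have hinj : Set.InjOn
      (fun p : (Σ _ : List Step, ℕ) => (p.1.take p.2, (0 : Step) :: (p.1.drop p.2).reverse))
      ↑(B.sigma (fun w => Finset.range w.length)) := by
    rintro ⟨w, k⟩ hp ⟨w', k'⟩ hp' he
    have hk := (memD _ (Finset.mem_coe.1 hp)).2.2.2.2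
    have hk' := (memD _ (Finset.mem_coe.1 hp')).2.2.2.2
    simp only [Prod.mk.injEq, List.cons.injEq, true_and, List.reverse_inj] at he
    dsimp only at hk hk'
    obtain ⟨ht, hd⟩ := he
    have hkk : k = k' := by
      have hl := congrArg List.length ht
      rw [List.length_take, List.length_take] at hl
      omega
    subst hkk
    have hww : w = w' := by
      rw [← List.take_append_drop k w, ht, hd, List.take_append_drop]
    subst hww
    rfl
  -- and lands in `H₁ × H₂`
  have hsub : (B.sigma (fun w => Finset.range w.length)).image
      (fun p : (Σ _ : List Step, ℕ) => (p.1.take p.2, (0 : Step) :: (p.1.drop p.2).reverse)) ⊆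
        H₁ ×ˢ H₂ := by
    intro q hq
    simp only [Finset.mem_image] at hq
    obtain ⟨p, hp, rfl⟩ := hq
    obtain ⟨hs, hb, he, hl, hk⟩ := memD p hp
    simp only [Finset.mem_product]
    refine ⟨hH₁ _ (hs.take _) (take_isHalfSpace hb p.2).1
        ((take_isHalfSpace hb p.2).2.trans_eq he) ?_,
      hH₂ _ (cons_reverse_drop_spec hs hb hk.le).1 (cons_reverse_drop_spec hs hb hk.le).2.1
        ((cons_reverse_drop_spec hs hb hk.le).2.2.trans_eq (by rw [he])) ?_⟩
    · rw [List.length_take]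
      omega
    · rw [List.length_cons, List.length_reverse, List.length_drop]
      omega
  calc ∑ w ∈ B, (w.length : ℝ) * criticalFugacity ^ w.length
      = ∑ p ∈ B.sigma (fun w => Finset.range w.length), criticalFugacity ^ p.1.length := e1
    _ = ∑ p ∈ B.sigma (fun w => Finset.range w.length), connectiveConstant *
          (criticalFugacity ^ (p.1.take p.2).length *
            criticalFugacity ^ ((0 : Step) :: (p.1.drop p.2).reverse).length) :=
        Finset.sum_congr rfl e2
    _ = connectiveConstant * ∑ q ∈ (B.sigma (fun w => Finset.range w.length)).image
          (fun p : (Σ _ : List Step, ℕ) => (p.1.take p.2, (0 : Step) :: (p.1.drop p.2).reverse)),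
          criticalFugacity ^ q.1.length * criticalFugacity ^ q.2.length := by
        rw [Finset.sum_image hinj, Finset.mul_sum]
    _ ≤ connectiveConstant * ∑ q ∈ H₁ ×ˢ H₂,
          criticalFugacity ^ q.1.length * criticalFugacity ^ q.2.length :=
        mul_le_mul_of_nonneg_left (Finset.sum_le_sum_of_subset_of_nonneg hsub
          fun q _ _ => mul_nonneg (pow_nonneg hx0 _) (pow_nonneg hx0 _)) hμ.le
    _ = connectiveConstant * ((∑ u ∈ H₁, criticalFugacity ^ u.length) *
          ∑ z ∈ H₂, criticalFugacity ^ z.length) := by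
        rw [Finset.sum_product, Finset.sum_mul_sum]
    _ ≤ connectiveConstant * (b₁ * b₂) := by
        refine mul_le_mul_of_nonneg_left (mul_le_mul hb₁ hb₂ ?_ ?_) hμ.le
        · exact Finset.sum_nonneg fun z _ => pow_nonneg hx0 _
        · exact (Finset.sum_nonneg fun u _ => pow_nonneg hx0 _).trans hb₁

/-- **Stub H6: `Λ_h ≤ 2 μ 4^h` in the word model, given Kesten's half-space bound.** If for all
`N, h` the critical mass of the self-avoiding half-space words of length `≤ N` and maximal first
coordinate `≤ h` is at most `2 ^ h`, then for all `N, h` the length-weighted critical mass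
`∑ |w| x_c^{|w|}` of the self-avoiding bridge words of span `h` and length `≤ N` is at most
`2 μ 4^h` (`lengthWordMass_le_of_split` with `b₁ = 2^h`, `b₂ = 2^{h+1}`).
[cite: MadrasSlade1993, §3.1] -/
theorem spanLengthWordMass_le : (∀ N h : ℕ, (∑ w ∈ (Finset.range (N + 1)).biUnion (fun n => (sawWords n).filter (fun w => Zd.IsHalfSpace w.length (traj w) ∧ Zd.maxLevel w.length (traj w) ≤ (h : ℤ))), criticalFugacity ^ w.length) ≤ 2 ^ h) → ∀ N h : ℕ, (∑ w ∈ (Finset.range (N + 1)).biUnion (fun n => (sawWords n).filter (fun w => IsBridgeW w ∧ xEnd w = (h : ℤ))), (w.length : ℝ) * criticalFugacity ^ w.length) ≤ 2 * connectiveConstant * 4 ^ h := by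
  intro hyp N h
  refine (lengthWordMass_le_of_split (L := (h : ℤ)) (N := N) ?_ ?_ ?_ (hyp N h)
    (hyp (N + 1) (h + 1))).trans (le_of_eq ?_)
  · intro w hw
    simp only [Finset.mem_biUnion, Finset.mem_range, Finset.mem_filter, mem_sawWords] at hw
    obtain ⟨n, hn, ⟨hl, hs⟩, hb, he⟩ := hw
    exact ⟨hs, hb, he, by omega⟩
  · intro u hs hh hm hl
    simp only [Finset.mem_biUnion, Finset.mem_range, Finset.mem_filter, mem_sawWords]
    exact ⟨u.length, by omega, ⟨rfl, hs⟩, hh, hm⟩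
  · intro z hs hh hm hl
    simp only [Finset.mem_biUnion, Finset.mem_range, Finset.mem_filter, mem_sawWords]
    refine ⟨z.length, by omega, ⟨rfl, hs⟩, hh, ?_⟩
    push_cast
    exact hm
  · rw [pow_succ, show (4 : ℝ) = 2 * 2 by norm_num, mul_pow]
    ring

end Summit.CriticalPhenomena.SAWScalingLimit.Theorems.CriticalBubbleBound.Kesten.HW

end
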